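import Summits.ResolutionOfSingularities.ResolutionOfSingularities.Theorems.MarkedTransferCampaignW46ApproximateExit
import Summits.ResolutionOfSingularities.ResolutionOfSingularities.Theorems.WildConesCampaignW46FormalChartLe
import Summits.ResolutionOfSingularities.ResolutionOfSingularities.Theorems.MarkedTransferCampaignW46MohWindowShadeFormalNRChart
import Literature.AlgebraicGeometry.Resolution.DiffOpLinearOverUnramified
import Literature.AlgebraicGeometry.Resolution.SharpOrderCoordinateCentre
import Literature.AlgebraicGeometry.Resolution.AlterationsFormalCoordinates
import Literature.RingTheory.MvPowerSeries.HasseDerivBasis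
import Literature.RingTheory.MvPowerSeries.MaximalIdealPow
import Literature.RingTheory.CompleteLocalRings.CoefficientFieldCharP
import Mathlib.RingTheory.AdicCompletion.Completeness
import HarnessLib

/-!
# [OURS · L1 W4.6 rung (iii-2)] HASSE-SPAN DOORS in power series rings: `Diff^{≤ n}((g)) = (Δ_α g : |α| ≤ n)`, invariance under ring
# isomorphisms of power series rings over perfect fields, coefficient extension, and the two-generator door

Cell `res-hironaka`, LADDER-RESOLUTION rung L (D-0089), slot W4.6 rung (iii); seat res-L1-s46-pv-5 (gen 7). Host route MarkedTransfer,
`--supports stmt-ResolutionOfSingularities-16155 --as helper`; kind proof (def-free). Plan `HOME/L/res-L1-s46-pv-5/NOTES.md` (gen 7, file F1a);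
the scheme-level PORTABLE DOOR built on it is `…WWalkPortableDoor.lean` (F1b).

WHY. Gen 6 closed o1's regime of record `regimeMohWindowSurfaceInsep` over ALGEBRAICALLY CLOSED fields: along a hit thread the W-walk is read
in Cohen coordinates over the ground field and its `T`-tail is killed by the approximate exit door (`…ApproximateExit`, tree
`IsolatedOrderPointApproximate`) at the tail's first point. Over a perfect NON-closed field the thread points are not rational, the Cohen
coefficient fields `L₀ ⊆ L₁ ⊆ ⋯` grow along the thread, and the tail ideal `(y − ψ_k(t), z − ζ_k(t))^p` has coefficients in the later
fields: the door at the first point (over `L_N`) does not see it. The remedy: the door is a statement about HASSE DERIVATIVES, and Hasse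
derivatives commute with coefficient maps.

WHAT (pure algebra; all ingredients are in the tree, this file is plumbing).
* `hasseSpan_le_diffIdeal`, `diffIdeal_span_singleton_le_hasseSpan` — `Diff^{≤ n}_A((g)) = (Δ_α g : |α| ≤ n)` in `A⟦X⟧` (the divided
  derivatives form a basis of `Diff^{≤ n}_{A⟦X⟧/A}`, EGA IV₄ 16.11.2, tree `HasseDerivBasis.diffOp_eq_span_hasseDeriv`; Leibniz `hasseDeriv_mul`);
* `diffIdeal_le_diffIdeal_of_isAlgebraic` — `Diff^{≤ n}_𝕂 ⊆ Diff^{≤ n}_L` for `L/𝕂` algebraic, `𝕂` perfect (tree `DiffOpLinearOverUnramified`);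
* `maximalIdeal_pow_le_hasseSpan_map` — the Hasse-span door `𝔪^N ⊆ (Δ_α g : |α| ≤ n)` passes to ANY coefficient extension (`map_hasseDeriv`);
* `exists_ringEquiv_apply_C`, `maximalIdeal_pow_le_hasseSpan_of_ringEquiv` — and along ANY ring isomorphism of power series rings over fields
  with perfect target of characteristic `p` (such an isomorphism maps constants to constants: UNIQUENESS of the coefficient field, Cohen 1946 /
  Matsumura §28, tree `CoefficientFieldCharP`);
* `not_span_le_span_pair_pow_sup_of_hasseSpan` — it gives back the two-generator door `(g) ⊄ (u, v)^b + 𝔪^{N+b}` (Leibniz + Nakayama + Krull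
  height, as in `…ApproximateExit`).

HONEST FRAMING. OURS; nothing here is a statement of H. Hironaka's manuscript [Hironaka2017] and nothing of it is used; no FACT-LIST premise.
AI-written; AI review is weaker than expert review. No `sorry`; axioms standard. References: EGA IV₄ Thm. 16.11.2, Prop. 16.8.8 [EGAIV4];
H. Matsumura, *Commutative Ring Theory* (1986) Thm. 25.3, §28 [Matsumura1987]; N. Bourbaki, *Algèbre commutative* III §4 no. 5
[Bourbaki1989CommAlg]; O. Villamayor U., Rev. Mat. Iberoam. 24 (2008) §4.1 [VillamayorU2008ReesDiff]; Stacks Project Tag 00DV [StacksProject].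
-/

noncomputable section

set_option linter.dupNamespace false -- mandated namespace of this single-conjunct summit

open IsLocalRing MvPowerSeries

namespace Summit.ResolutionOfSingularities.ResolutionOfSingularities.Theorems

namespace CampaignW46

namespace WWalk

open Literature.AlgebraicGeometry.Resolution
open Literature.RingTheory.MvPowerSeries (hasseDeriv hasseDeriv_mul map_hasseDeriv isDiffOpLE_hasseDeriv diffOp_eq_span_hasseDeriv)
open Literature.RingTheory.MvPowerSeries.Jets (mem_maximalIdeal_iff_constantCoeff_eq_zero maximalIdeal_pow_eq_span_monomial
  monomial_mem_maximalIdeal_pow)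
open CampaignW46.FormalChart (ringEquiv_mem_maximalIdeal ringEquiv_mem_maximalIdeal_pow)

/-! ## §1 Hasse spans in power series rings -/

section HasseSpan

variable {A : Type*} [CommRing A] {τ : Type*} [Fintype τ] [DecidableEq τ]

/-- `(Δ_α g : |α| ≤ n) ⊆ Diff^{≤ n}_A((g))`: divided derivatives are differential operators of order `≤ |α|`.
[cite: EGAIV4, Prop. 16.8.8 (b) and Thm. 16.11.2] -/
theorem hasseSpan_le_diffIdeal (n : ℕ) (g : MvPowerSeries τ A) :
    Ideal.span ((fun α : τ →₀ ℕ => hasseDeriv α g) '' {α | α.degree ≤ n}) ≤ diffIdeal A n (Ideal.span {g}) := by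
  rw [Ideal.span_le]
  rintro _ ⟨α, hα, rfl⟩
  exact apply_mem_diffIdeal A (isDiffOpLE_hasseDeriv n α hα) (Ideal.subset_span rfl)

/-- `Diff^{≤ n}_A((g)) ⊆ (Δ_α g : |α| ≤ n)`: every `A`-linear differential operator of order `≤ n` of `A⟦X⟧` is an `A⟦X⟧`-combination of
the `Δ_α`, `|α| ≤ n` (EGA IV₄ 16.11.2 for `A⟦X⟧/A`), and `Δ_α(h g) = Σ_{β+γ=α} Δ_β h · Δ_γ g` (higher Leibniz rule).
[cite: EGAIV4, Thm. 16.11.2] [cite: Matsumura1987, §27 (Leibniz rule for higher derivations)] -/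
theorem diffIdeal_span_singleton_le_hasseSpan (n : ℕ) (g : MvPowerSeries τ A) :
    diffIdeal A n (Ideal.span {g}) ≤ Ideal.span ((fun α : τ →₀ ℕ => hasseDeriv α g) '' {α | α.degree ≤ n}) := by
  classical
  rw [diffIdeal_le_iff]
  intro D hD f hf
  obtain ⟨h, rfl⟩ := Ideal.mem_span_singleton'.mp hf
  have hDmem : D ∈ diffOp A (MvPowerSeries τ A) n := mem_diffOp_iff.mpr hD
  rw [diffOp_eq_span_hasseDeriv] at hDmem
  refine Submodule.span_induction (p := fun D _ => D (h * g) ∈ Ideal.span ((fun α : τ →₀ ℕ => hasseDeriv α g) '' {α | α.degree ≤ n}))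
    ?_ ?_ ?_ ?_ hDmem
  · rintro _ ⟨α, hα, rfl⟩
    show Literature.RingTheory.MvPowerSeries.hasseDeriv α (h * g) ∈ _
    rw [Literature.RingTheory.MvPowerSeries.hasseDeriv_mul]
    refine Ideal.sum_mem _ fun ab hab => Ideal.mul_mem_left _ _ (Ideal.subset_span ⟨ab.2, ?_, rfl⟩)
    have heq : ab.1 + ab.2 = α := Finset.HasAntidiagonal.mem_antidiagonal.mp hab
    show ab.2.degree ≤ n
    have hle : ab.2.degree ≤ α.degree := by rw [← heq, map_add]; exact Nat.le_add_left _ _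
    exact hle.trans hα
  · rw [LinearMap.zero_apply]; exact Ideal.zero_mem _
  · intro D₁ D₂ _ _ h₁ h₂
    rw [LinearMap.add_apply]; exact Ideal.add_mem _ h₁ h₂
  · intro c D _ hD'
    rw [LinearMap.smul_apply, smul_eq_mul]; exact Ideal.mul_mem_left _ _ hD'

end HasseSpan

/-! ## §1b `Diff^{≤ n}` over `𝕂` versus over an algebraic extension `L` (`𝕂` perfect) -/

section Tower

variable {𝕂 L B : Type*} [Field 𝕂] [Field L] [CommRing B] [Algebra 𝕂 L] [Algebra L B] [Algebra 𝕂 B] [IsScalarTower 𝕂 L B]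

/-- `Diff^{≤ n}_𝕂(I) ⊆ Diff^{≤ n}_L(I)` for an algebra `B` over a tower `𝕂 → L → B` with `L` algebraic over the perfect field `𝕂`: a
`𝕂`-differential operator of order `≤ n` is `L`-linear and an `L`-differential operator of the same order (`L/𝕂` is separable, hence formally
unramified). [cite: Matsumura1987, Thm. 25.3] [cite: EGAIV4, Prop. 16.8.8] -/
theorem diffIdeal_le_diffIdeal_of_isAlgebraic [PerfectField 𝕂] [Algebra.IsAlgebraic 𝕂 L] (n : ℕ) (I : Ideal B) :
    diffIdeal 𝕂 n I ≤ diffIdeal L n I := by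
  rw [diffIdeal_le_iff]
  intro D hD f hf
  haveI : Algebra.IsSeparable 𝕂 L := Algebra.IsAlgebraic.isSeparable_of_perfectField
  haveI : Algebra.FormallyUnramified 𝕂 L := Algebra.FormallyUnramified.of_isSeparable 𝕂 L
  obtain ⟨D', hD', hD'n⟩ := hD.exists_linearMap_over (L := L)
  rw [← hD']
  exact apply_mem_diffIdeal L hD'n hf

end Tower

/-! ## §1c Hasse spans under coefficient extension and under ring isomorphisms of power series rings -/

section BaseChange

variable {κ Ω : Type*} [Field κ] [Field Ω] {τ : Type*} [Fintype τ]

/-- **Coefficient extension**: `𝔪^N ⊆ (Δ_α g : |α| ≤ n)` in `κ⟦X⟧` implies the same in `Ω⟦X⟧` for `g ⊗ Ω` along any `φ : κ → Ω`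
(`𝔪^N` is generated by monomials; `Δ_α` commutes with coefficient maps). [cite: Bourbaki1989CommAlg, Ch. III §4 no. 5 (21)] -/
theorem maximalIdeal_pow_le_hasseSpan_map (φ : κ →+* Ω) {n N : ℕ} {g : MvPowerSeries τ κ}
    (h : maximalIdeal (MvPowerSeries τ κ) ^ N ≤ Ideal.span ((fun α : τ →₀ ℕ => hasseDeriv α g) '' {α | α.degree ≤ n})) :
    maximalIdeal (MvPowerSeries τ Ω) ^ N ≤
      Ideal.span ((fun α : τ →₀ ℕ => hasseDeriv α (MvPowerSeries.map φ g)) '' {α | α.degree ≤ n}) := by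
  classical
  have himage : (Ideal.span ((fun α : τ →₀ ℕ => hasseDeriv α g) '' {α | α.degree ≤ n})).map (MvPowerSeries.map φ) ≤
      Ideal.span ((fun α : τ →₀ ℕ => hasseDeriv α (MvPowerSeries.map φ g)) '' {α | α.degree ≤ n}) := by
    rw [Ideal.map_span]
    refine Ideal.span_mono ?_
    rintro _ ⟨_, ⟨α, hα, rfl⟩, rfl⟩
    exact ⟨α, hα, (map_hasseDeriv φ α g).symm⟩
  rw [maximalIdeal_pow_eq_span_monomial, Ideal.span_le]
  rintro _ ⟨e, he, rfl⟩
  have h1 : MvPowerSeries.monomial e (1 : κ) ∈ maximalIdeal (MvPowerSeries τ κ) ^ N :=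
    monomial_mem_maximalIdeal_pow (le_of_eq he.symm) 1
  have h2 := himage (Ideal.mem_map_of_mem (MvPowerSeries.map φ) (h h1))
  rwa [MvPowerSeries.map_monomial, map_one] at h2

end BaseChange

section Constants

variable {κ L : Type} [Field κ] [Field L] [PerfectField L] {τ τ' : Type} [Fintype τ] [Fintype τ']

omit [Fintype τ] in
/-- **A ring isomorphism `κ⟦X_τ⟧ ≅ L⟦X_{τ'}⟧` maps constants to constants** when `L` is PERFECT of characteristic `p`: the image of the
constants `κ` is a coefficient field of the complete local ring `L⟦X⟧`, whose coefficient field is UNIQUE (perfect residue field).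
[cite: Matsumura1987, §28 p. 215 and Thm. 28.3 (ii)] -/
theorem exists_ringEquiv_apply_C (p : ℕ) [hp : Fact p.Prime] [CharP L p] (θ : MvPowerSeries τ κ ≃+* MvPowerSeries τ' L) :
    ∃ θ₀ : κ ≃+* L, ∀ c : κ, θ (MvPowerSeries.C c) = MvPowerSeries.C (θ₀ c) := by
  classical
  set B := MvPowerSeries τ' L with hB
  -- `B` is a complete local ring of characteristic `p` with residue field `≅ L`
  have h𝔪 : maximalIdeal B = Ideal.span (Set.range (X : τ' → B)) := MohWindowShadeFormalNR.maximalIdeal_eq_span_range_X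
  haveI : IsAdicComplete (maximalIdeal B) B := by rw [h𝔪]; infer_instance
  haveI : CharP B p := charP_of_injective_ringHom (MvPowerSeries.C_injective (σ := τ') (R := L)) p
  -- the residue field of `B` is `L`
  have hker : RingHom.ker (MvPowerSeries.constantCoeff : B →+* L) = maximalIdeal B := by
    ext b; rw [RingHom.mem_ker, mem_maximalIdeal_iff_constantCoeff_eq_zero]
  have hsurjc : Function.Surjective (MvPowerSeries.constantCoeff : B →+* L) := fun l => ⟨MvPowerSeries.C l, MvPowerSeries.constantCoeff_C l⟩
  let θL : ResidueField B ≃+* L := (Ideal.quotEquivOfEq hker.symm).trans (RingHom.quotientKerEquivOfSurjective hsurjc)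
  have hθL : ∀ b : B, θL (residue B b) = MvPowerSeries.constantCoeff b := fun b => by
    change (RingHom.quotientKerEquivOfSurjective hsurjc) ((Ideal.quotEquivOfEq hker.symm) (Ideal.Quotient.mk _ b)) = _
    rw [Ideal.quotEquivOfEq_mk]
    exact RingHom.quotientKerEquivOfSurjective_apply_mk hsurjc b
  haveI : PerfectField (ResidueField B) := by
    haveI : CharP (ResidueField B) p := charP_of_injective_ringHom (f := θL.symm.toRingHom) θL.symm.injective p
    haveI : PerfectRing L p := PerfectField.toPerfectRing p
    haveI : PerfectRing (ResidueField B) p := by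
      refine PerfectRing.ofSurjective _ p fun x => ?_
      obtain ⟨l, hl⟩ := (bijective_frobenius L p).2 (θL x)
      refine ⟨θL.symm l, ?_⟩
      apply θL.injective
      rw [frobenius_def, map_pow, RingEquiv.apply_symm_apply, ← frobenius_def, hl]
    exact PerfectRing.toPerfectField (ResidueField B) p
  -- the standard section `C ∘ θL`
  set τ₀ : ResidueField B →+* B := (MvPowerSeries.C : L →+* B).comp θL.toRingHom with hτ₀def
  have hτ₀ : ∀ x, residue B (τ₀ x) = x := by
    intro x
    obtain ⟨b, rfl⟩ := residue_surjective x
    rw [hτ₀def, RingHom.comp_apply]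
    change residue B (MvPowerSeries.C (θL (residue B b))) = residue B b
    rw [hθL, ← sub_eq_zero, ← map_sub, residue_eq_zero_iff, mem_maximalIdeal_iff_constantCoeff_eq_zero, map_sub,
      MvPowerSeries.constantCoeff_C, sub_self]
  -- the section through `θ`: `κ → B`, `c ↦ θ (C c)`, is a bijection onto the residue field
  set j : κ →+* B := θ.toRingHom.comp MvPowerSeries.C with hj
  have hjapp : ∀ c, j c = θ (MvPowerSeries.C c) := fun c => rfl
  have hρbij : Function.Bijective ((residue B).comp j) := by
    constructor
    · exact ((residue B).comp j).injective
    · intro x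
      obtain ⟨b, rfl⟩ := residue_surjective x
      obtain ⟨a, rfl⟩ := θ.surjective b
      refine ⟨MvPowerSeries.constantCoeff a, ?_⟩
      rw [RingHom.comp_apply, hjapp, ← sub_eq_zero, ← map_sub, residue_eq_zero_iff]
      change θ.toRingHom (MvPowerSeries.C (MvPowerSeries.constantCoeff a)) - θ.toRingHom a ∈ maximalIdeal B
      rw [← map_sub]
      exact ringEquiv_mem_maximalIdeal θ (mem_maximalIdeal_iff_constantCoeff_eq_zero.mpr (by
        rw [map_sub, MvPowerSeries.constantCoeff_C, sub_self]))
  set ρ : κ ≃+* ResidueField B := RingEquiv.ofBijective _ hρbij with hρ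
  set σ₀ : ResidueField B →+* B := j.comp ρ.symm.toRingHom with hσ₀def
  have hσ₀ : ∀ x, residue B (σ₀ x) = x := by
    intro x
    rw [hσ₀def, RingHom.comp_apply]
    change ((residue B).comp j) (ρ.symm x) = x
    have : ((residue B).comp j) (ρ.symm x) = ρ (ρ.symm x) := rfl
    rw [this, RingEquiv.apply_symm_apply]
  -- uniqueness of the coefficient field
  have huniq := Literature.RingTheory.CompleteLocalRings.ringHom_eq_of_comp_residue_eq_id_of_perfectField (A := B) p hp.out σ₀ τ₀ hσ₀ hτ₀
  refine ⟨ρ.trans θL, fun c => ?_⟩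
  have h1 : θ (MvPowerSeries.C c) = σ₀ (ρ c) := by
    rw [hσ₀def, RingHom.comp_apply]
    change _ = j (ρ.symm (ρ c))
    rw [RingEquiv.symm_apply_apply, hjapp]
  rw [h1, huniq, hτ₀def, RingHom.comp_apply, RingEquiv.trans_apply]
  rfl

/-- **Transport of a Hasse-span door along any ring isomorphism of power series rings** (target coefficient field perfect of
characteristic `p`): `𝔪^N ⊆ (Δ_α g : |α| ≤ n)` in `κ⟦X_τ⟧` implies `𝔪^N ⊆ (Δ_α (θ g) : |α| ≤ n)` in `L⟦X_{τ'}⟧`. Indeed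
`θ = (⊗ θ₀) ∘ θ′` with `θ₀ : κ ≅ L` the action on constants and `θ′` a `κ`-ALGEBRA isomorphism, under which `Diff^{≤ n}_κ` is intrinsic.
[cite: EGAIV4, Thm. 16.11.2 and Prop. 16.8.8 (b)] [cite: Matsumura1987, §28 p. 215] -/
theorem maximalIdeal_pow_le_hasseSpan_of_ringEquiv (p : ℕ) [Fact p.Prime] [CharP L p] [DecidableEq τ] [DecidableEq τ']
    (θ : MvPowerSeries τ κ ≃+* MvPowerSeries τ' L)
    {n N : ℕ} {g : MvPowerSeries τ κ}
    (h : maximalIdeal (MvPowerSeries τ κ) ^ N ≤ Ideal.span ((fun α : τ →₀ ℕ => hasseDeriv α g) '' {α | α.degree ≤ n})) :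
    maximalIdeal (MvPowerSeries τ' L) ^ N ≤ Ideal.span ((fun α : τ' →₀ ℕ => hasseDeriv α (θ g)) '' {α | α.degree ≤ n}) := by
  classical
  obtain ⟨θ₀, hθ₀⟩ := exists_ringEquiv_apply_C p θ
  -- `θ′ := (⊗ θ₀⁻¹) ∘ θ` is a `κ`-algebra isomorphism
  set θ₁ : MvPowerSeries τ κ ≃+* MvPowerSeries τ' κ := θ.trans (MvPowerSeries.mapRingEquiv θ₀.symm) with hθ₁
  have hθ₁C : ∀ c : κ, θ₁ (MvPowerSeries.C c) = MvPowerSeries.C c := by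
    intro c
    rw [hθ₁, RingEquiv.trans_apply, hθ₀]
    change MvPowerSeries.map (σ := τ') θ₀.symm.toRingHom (MvPowerSeries.C (θ₀ c)) = _
    rw [MvPowerSeries.map_C]
    change MvPowerSeries.C (θ₀.symm (θ₀ c)) = _
    rw [RingEquiv.symm_apply_apply]
  let θ' : MvPowerSeries τ κ ≃ₐ[κ] MvPowerSeries τ' κ :=
    AlgEquiv.ofRingEquiv (f := θ₁) fun c => by rw [MvPowerSeries.algebraMap_apply, Algebra.algebraMap_self_apply, hθ₁C]; rfl
  have hθ'app : ∀ f, θ' f = θ₁ f := fun f => rfl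
  -- `θ g = map θ₀ (θ′ g)`
  have hθg : θ g = MvPowerSeries.map (σ := τ') θ₀.toRingHom (θ' g) := by
    rw [hθ'app, hθ₁, RingEquiv.trans_apply]
    change θ g = MvPowerSeries.mapRingEquiv θ₀ (MvPowerSeries.mapRingEquiv θ₀.symm (θ g))
    have : MvPowerSeries.mapRingEquiv (σ := τ') θ₀ (MvPowerSeries.mapRingEquiv θ₀.symm (θ g)) =
        (MvPowerSeries.mapRingEquiv θ₀.symm).trans (MvPowerSeries.mapRingEquiv θ₀) (θ g) := rfl
    rw [this]
    have htr : (MvPowerSeries.mapRingEquiv (σ := τ') θ₀.symm).trans (MvPowerSeries.mapRingEquiv θ₀) = RingEquiv.refl _ := by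
      apply RingEquiv.ext
      intro f
      ext e
      change MvPowerSeries.coeff e (MvPowerSeries.map θ₀.toRingHom (MvPowerSeries.map θ₀.symm.toRingHom f)) = MvPowerSeries.coeff e f
      rw [MvPowerSeries.coeff_map, MvPowerSeries.coeff_map]
      exact θ₀.apply_symm_apply _
    rw [htr]; rfl
  -- the door for `θ′ g` over `κ`
  have hκ : maximalIdeal (MvPowerSeries τ' κ) ^ N ≤ Ideal.span ((fun α : τ' →₀ ℕ => hasseDeriv α (θ' g)) '' {α | α.degree ≤ n}) := by
    have h1 : maximalIdeal (MvPowerSeries τ κ) ^ N ≤ diffIdeal κ n (Ideal.span {g}) := h.trans (hasseSpan_le_diffIdeal n g)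
    have h2 : maximalIdeal (MvPowerSeries τ' κ) ^ N ≤ (maximalIdeal (MvPowerSeries τ κ) ^ N).map θ' := by
      intro x hx
      have hx' : θ'.symm x ∈ maximalIdeal (MvPowerSeries τ κ) ^ N := ringEquiv_mem_maximalIdeal_pow θ'.symm.toRingEquiv hx
      have := Ideal.mem_map_of_mem θ' hx'
      rwa [AlgEquiv.apply_symm_apply] at this
    refine h2.trans ((Ideal.map_mono h1).trans ?_)
    rw [diffIdeal_map_algEquiv, Ideal.map_span, Set.image_singleton]
    exact diffIdeal_span_singleton_le_hasseSpan n (θ' g)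
  rw [hθg]
  exact maximalIdeal_pow_le_hasseSpan_map θ₀.toRingHom hκ

end Constants

/-! ## §1d The two-generator door from a Hasse-span door -/

section TwoGenerator

variable {L : Type} [Field L]

/-- **Hasse-span door ⇒ two-generator door** in `L⟦t, y, z⟧`: if `𝔪^N ⊆ (Δ_α g : |α| ≤ b − 1)` then `(g) ⊄ (u, v)^b + 𝔪^{N+b}` for all
`u, v ∈ 𝔪` (operators of order `≤ b − 1` send `(u, v)^b` into `(u, v)` and `𝔪^{N+b}` into `𝔪^{N+1}`; Nakayama gives `𝔪^N ⊆ (u, v)`, against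
Krull's height theorem in dimension `3`). [cite: VillamayorU2008ReesDiff, §4.1] [cite: StacksProject, Tag 00DV] -/
theorem not_span_le_span_pair_pow_sup_of_hasseSpan {b N : ℕ} (hb : 0 < b) {g : MvPowerSeries (Option (Fin 2)) L}
    (h : maximalIdeal (MvPowerSeries (Option (Fin 2)) L) ^ N ≤
      Ideal.span ((fun α : Option (Fin 2) →₀ ℕ => hasseDeriv α g) '' {α | α.degree ≤ b - 1}))
    {u v : MvPowerSeries (Option (Fin 2)) L} (hu : u ∈ maximalIdeal _) (hv : v ∈ maximalIdeal _) :
    ¬ Ideal.span {g} ≤ Ideal.span {u, v} ^ b ⊔ maximalIdeal (MvPowerSeries (Option (Fin 2)) L) ^ (N + b) := by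
  classical
  intro hle
  haveI : IsRegularLocalRing (MvPowerSeries (Option (Fin 2)) L) := isRegularLocalRing_mvPowerSeries L (Option (Fin 2))
  have h2 : diffIdeal L (b - 1) (Ideal.span {g}) ≤ Ideal.span {u, v} ⊔ maximalIdeal _ ^ (N + b - (b - 1)) :=
    diffIdeal_le_sup_pow_of_le_sup_pow L (by rw [Nat.sub_add_cancel hb]; exact hle)
  rw [show N + b - (b - 1) = N + 1 by omega] at h2
  have hN : maximalIdeal (MvPowerSeries (Option (Fin 2)) L) ^ N ≤ Ideal.span {u, v} :=
    pow_le_of_pow_le_of_le_sup_pow_succ (maximalIdeal_le_jacobson _) (IsNoetherian.noetherian _)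
      (h.trans (hasseSpan_le_diffIdeal (b - 1) g)) h2
  exact not_pow_maximalIdeal_le_span_pair_mvPowerSeries hu hv N hN

end TwoGenerator

end WWalk

end CampaignW46

end Summit.ResolutionOfSingularities.ResolutionOfSingularities.Theorems

end
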